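import Literature.Computability.QuantumComplexity.ZXCalculusC2AntiC2
import HarnessLib

/-!
# ZX-calculus: the NOT-triangle symmetry `T ⨾ Z(π) ⨾ Tᵗ = X(π) ⨾ T` (Appendix Lemma 31) and
JPV LICS 2019, Lemma `2-through-triangle` (NF-L5)

[cite: JeandelPerdrixVilmart2018, Appendix Lemma 31 (rule (BW) with triangles); JPV, *A Generic Normal Form for ZX-Diagrams* (LICS 2019), Appendix]
-/

namespace Literature.Computability.QuantumComplexity

open ZXDiagram

namespace ZXClass

/-- **Appendix Lemma 31** (`not-ug-is-symmetrical`, rule (BW) written with triangles): `T ⨾ Z(π) ⨾ Tᵗ = X(π) ⨾ T`.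
[cite: JeandelPerdrixVilmart2018, Appendix Lemma 31; Fig. 1 (BW)] -/
theorem triangle_seq_Z_pi_seq_triangleT : mk triangle ⨟ mk (Z 1 1 4) ⨟ (mk triangle).transpose = mk (X 1 1 4) ⨟ mk triangle := by
  -- `db 4 (π/2) ⊗ Tᵗ = √2 ⊗ (X(π/2) ⨾ Z(π/4) ⨾ xLeafL 0 (π/4) ⨾ T₊)`
  have hTt : mk (dumbbell 4 2) ⊠ (mk triangle).transpose = mk (dumbbell 0 0) ⊠ (mk (X 1 1 2) ⨟ mk (Z 1 1 1) ⨟ mk (xLeafL 0 1) ⨟ mk (bwT 0)) := by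
    have h := congrArg transpose triangle_flip
    rw [transpose_par, transpose_par, transpose_mk (dumbbell 4 2), transpose_mk (dumbbell 0 0), mk_transpose_dumbbell, mk_transpose_dumbbell,
      transpose_seq, transpose_seq, transpose_seq, bwT_zero_transpose, transpose_mk (xLeafL 0 1), mk_transpose_xLeafL, transpose_mk (Z 1 1 1),
      transpose_mk (X 1 1 2), ZXDiagram.transpose_Z, ZXDiagram.transpose_X] at h
    simpa only [seq_assoc] using h
  refine cancel_dumbbell_four_one_one 2 (cancel_dumbbell_four_one_one 2 ?_)
  rw [← seq_scalar_par_one (mk (dumbbell 4 2)) (mk triangle ⨟ mk (Z 1 1 4)), hTt, seq_scalar_par_one, scalar_par_scalar_par (mk (dumbbell 4 2)) (mk (dumbbell 0 0)),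
    ← scalar_par_seq_one (mk (dumbbell 4 2)), ← scalar_par_seq_one (mk (dumbbell 4 2)) (mk triangle), triangle_flip, scalar_par_seq_one, scalar_par_seq_one]
  -- the spine: `T₊ xL Z1 X2 ⨾ Zπ ⨾ X2 Z1 xL T₊`, with `√2 ⊗ (X2 ⨾ Zπ ⨾ X2) = db 2 4 ⊗ Zπ`
  rw [show (mk (bwT 0) ⨟ mk (xLeafL 0 1) ⨟ mk (Z 1 1 1) ⨟ mk (X 1 1 2)) ⨟ mk (Z 1 1 4) ⨟ (mk (X 1 1 2) ⨟ mk (Z 1 1 1) ⨟ mk (xLeafL 0 1) ⨟ mk (bwT 0)) =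
      (mk (bwT 0) ⨟ mk (xLeafL 0 1) ⨟ mk (Z 1 1 1)) ⨟ (mk (X 1 1 2) ⨟ mk (Z 1 1 4) ⨟ mk (X 1 1 2)) ⨟ (mk (Z 1 1 1) ⨟ mk (xLeafL 0 1) ⨟ mk (bwT 0)) from by simp only [seq_assoc],
    seq_assoc _ (mk (X 1 1 2) ⨟ mk (Z 1 1 4) ⨟ mk (X 1 1 2)), ← seq_scalar_par_one (mk (dumbbell 0 0)) (mk (bwT 0) ⨟ mk (xLeafL 0 1) ⨟ mk (Z 1 1 1)),
    ← scalar_par_seq_one (mk (dumbbell 0 0)) (mk (X 1 1 2) ⨟ mk (Z 1 1 4) ⨟ mk (X 1 1 2)), sqrt_two_par_X_two_seq_Z_pi_seq_X_two, scalar_par_seq_one, seq_scalar_par_one,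
    show (mk (bwT 0) ⨟ mk (xLeafL 0 1) ⨟ mk (Z 1 1 1)) ⨟ (mk (Z 1 1 4) ⨟ (mk (Z 1 1 1) ⨟ mk (xLeafL 0 1) ⨟ mk (bwT 0))) = mk bwLhs from by
      simp only [seq_assoc]
      rw [← seq_assoc (mk (Z 1 1 1)) (mk (Z 1 1 4)), phase_seq_phase, ← seq_assoc (mk (Z 1 1 (1 + 4))) (mk (Z 1 1 1)), phase_seq_phase,
        show (1 + 4 + 1 : ZMod 8) = -2 from by decide]
      simp only [bwLhs, mk_seq, seq_assoc],
    rule_BW, ← X_pi_seq_trianglePlus, ← seq_scalar_par_one (mk (dumbbell 4 2)) (mk (X 1 1 4)) (mk triangle), triangle_flip, seq_scalar_par_one,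
    dumbbell_comm_colors 2 4, scalar_par_scalar_par (mk (dumbbell 4 2)) (mk (dumbbell 0 0))]

/-! ### Sliding the triangle around a cup -/

/-- Sliding two pieces in turn around a cup. [cite: JeandelPerdrixVilmart2018, §2.2] -/
theorem cup_slide_seq {P Q P' Q' : ZXClass 1 1} (hP : mk cup ⨟ (mk (wires 1) ⊠ P) = mk cup ⨟ (P' ⊠ mk (wires 1))) (hQ : mk cup ⨟ (mk (wires 1) ⊠ Q) = mk cup ⨟ (Q' ⊠ mk (wires 1))) :
    mk cup ⨟ (mk (wires 1) ⊠ (P ⨟ Q)) = mk cup ⨟ ((Q' ⨟ P') ⊠ mk (wires 1)) := by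
  rw [wires_par_seq, ← seq_assoc, hP, seq_assoc, slide, ← seq_assoc, hQ, seq_assoc, ← seq_par_wires]

/-- A green phase slides around the cup. [cite: JeandelPerdrixVilmart2018, §2.2] -/
theorem cup_seq_par_phase_comm (a : ZMod 8) : mk cup ⨟ (mk (wires 1) ⊠ mk (Z 1 1 a)) = mk cup ⨟ (mk (Z 1 1 a) ⊠ mk (wires 1)) := by
  rw [cup_seq_par_phase, ← cup_swap, seq_assoc, swap_seq_par_one_one, ← seq_assoc, cup_seq_par_phase, Z_seq_swap]

/-- The gadget node of the triangle slides around the cup. [cite: JeandelPerdrixVilmart2018, §2.2] -/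
theorem cup_seq_par_gadgetNode : mk cup ⨟ (mk (wires 1) ⊠ (mk (Z 1 2 0) ⨟ (mk (wires 1) ⊠ (mk (X 1 2 0) ⨟ (mk (Z 1 0 (-1)) ⊠ mk (Z 1 0 (-1))))))) = mk cup ⨟ ((mk (Z 1 2 0) ⨟ (mk (wires 1) ⊠ (mk (X 1 2 0) ⨟ (mk (Z 1 0 (-1)) ⊠ mk (Z 1 0 (-1)))))) ⊠ mk (wires 1)) := by
  rw [wires_par_seq, ← seq_assoc, ← Z_zero_three_eq_cup_par_split, seq_par_wires, ← seq_assoc, ← Z_zero_three_eq_cup_split_par,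
    show (mk (wires 1) ⊠ (mk (X 1 2 0) ⨟ (mk (Z 1 0 (-1)) ⊠ mk (Z 1 0 (-1))))) ⊠ mk (wires 1) = mk (wires 1) ⊠ ((mk (X 1 2 0) ⨟ (mk (Z 1 0 (-1)) ⊠ mk (Z 1 0 (-1)))) ⊠ mk (wires 1)) from (par_assoc _ _ _).trans (cast_id _ _ _), ← swap_seq_effect_par, wires_par_seq,
    ← seq_assoc, Z_zero_three_seq_par_swap]

/-- **The triangle slides around the cup as its transpose**: `∪ ⨾ (𝕀 ⊗ T) = ∪ ⨾ (Tᵗ ⊗ 𝕀)`. [cite: JeandelPerdrixVilmart2018, §2.2, §6] -/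
theorem cup_seq_par_triangle : mk cup ⨟ (mk (wires 1) ⊠ mk triangle) = mk cup ⨟ ((mk triangle).transpose ⊠ mk (wires 1)) := by
  have hT : mk triangle = (mk (Z 1 2 0) ⨟ (mk (wires 1) ⊠ (mk (X 1 2 0) ⨟ (mk (Z 1 0 (-1)) ⊠ mk (Z 1 0 (-1)))))) ⨟ ((mk (xLeafL 0 1) ⨟ mk (Z 1 1 1)) ⨟ mk (X 1 1 2)) := by
    rw [mk_triangle, seq_assoc, seq_assoc, ← seq_assoc (mk (xLeafL 0 1))]
  rw [triangle_transpose_explicit, hT, cup_slide_seq cup_seq_par_gadgetNode (cup_slide_seq (cup_slide_seq (cup_seq_par_xLeafL 1) (cup_seq_par_phase_comm 1)) (cup_seq_par_xphase 2))]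
  simp only [seq_assoc]

/-- The transposed triangle slides around the cup as the triangle. [cite: JeandelPerdrixVilmart2018, §2.2, §6] -/
theorem cup_seq_par_triangleT : mk cup ⨟ (mk (wires 1) ⊠ (mk triangle).transpose) = mk cup ⨟ (mk triangle ⊠ mk (wires 1)) := by
  rw [← cup_swap, seq_assoc, swap_seq_par_phase, ← seq_assoc, ← cup_seq_par_triangle, seq_assoc, ← swap_seq_par_one_one, ← seq_assoc, cup_swap]

/-! ### The pendant effect `T ⨾ Z^{(1,0)}` bent into the pendant state `Z^{(0,1)} ⨾ Tᵗ` -/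

/-- `∪ ⨾ (𝕀 ⊗ (T ⨾ Z^{(1,0)})) = Z^{(0,1)} ⨾ Tᵗ`. [cite: JeandelPerdrixVilmart2018, §2.2, §6] -/
theorem cup_seq_par_triangle_effect : mk cup ⨟ (mk (wires 1) ⊠ (mk triangle ⨟ mk (Z 1 0 0))) = mk (Z 0 1 0) ⨟ (mk triangle).transpose := by
  rw [wires_par_seq, ← seq_assoc, cup_seq_par_triangle, seq_assoc, slide, ← seq_assoc, cup_seq_par_effect, par_empty]

/-- **A green node with the pendant effect `T ⨾ Z^{(1,0)}` is the merge with the pendant state `Z^{(0,1)} ⨾ Tᵗ`**: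
`Z^{(1,2)} ⨾ (𝕀 ⊗ (T ⨾ Z^{(1,0)})) = (𝕀 ⊗ (Z^{(0,1)} ⨾ Tᵗ)) ⨾ Z^{(2,1)}`. [cite: JeandelPerdrixVilmart2018, §2.2, §6] -/
theorem split_par_triangleEffect_eq_par_stateT_merge :
    mk (Z 1 2 0) ⨟ (mk (wires 1) ⊠ (mk triangle ⨟ mk (Z 1 0 0))) = (mk (wires 1) ⊠ (mk (Z 0 1 0) ⨟ (mk triangle).transpose)) ⨟ mk (Z 2 1 0) := by
  rw [← par_cup_seq_merge_par, seq_assoc, slide, ← seq_assoc, par_empty,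
    show mk (wires 2) ⊠ (mk triangle ⨟ mk (Z 1 0 0)) = mk (wires 1) ⊠ (mk (wires 1) ⊠ (mk triangle ⨟ mk (Z 1 0 0))) from by rw [← wires_par_wires 1 1]; exact (par_assoc _ _ _).trans (cast_id _ _ _),
    ← wires_par_seq, cup_seq_par_triangle_effect]

/-! ### The doubling node and the lemma -/

/-- Two states swap. [cite: JeandelPerdrixVilmart2018, §2.2] -/
theorem states_seq_swap (u v : ZXClass 0 1) : (u ⊠ v) ⨟ mk swap = v ⊠ u := by
  rw [par_eq_seq_left u v, par_empty, seq_assoc, par_state_seq_swap, par_eq_seq_right v u, empty_par_state]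

/-- **The doubling node** (a green node with the pendant `T ⨾ Z^{(1,0)}`, `⟦·⟧ = diag(1,2)`) **through `X(π)`**:
the pendant triangle flips. [cite: JeandelPerdrixVilmart2018, Fig. 1 (K); Appendix Lemma 21] -/
theorem doublingNode_seq_X_pi : (mk (Z 1 2 0) ⨟ (mk (wires 1) ⊠ (mk triangle ⨟ mk (Z 1 0 0)))) ⨟ (mk (X 1 1 4)) = (mk (X 1 1 4)) ⨟ (mk (Z 1 2 0) ⨟ (mk (wires 1) ⊠ ((mk triangle).transpose ⨟ mk (Z 1 0 0)))) := by
  rw [seq_assoc, show (mk (wires 1) ⊠ (mk triangle ⨟ mk (Z 1 0 0))) ⨟ (mk (X 1 1 4)) = ((mk (X 1 1 4)) ⊠ mk (wires 1)) ⨟ (mk (wires 1) ⊠ (mk triangle ⨟ mk (Z 1 0 0))) from by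
      rw [← par_eq_seq_left, par_eq_seq_right (mk (X 1 1 4)) (mk triangle ⨟ mk (Z 1 0 0)), par_empty],
    ← seq_assoc, show mk (Z 1 2 0) ⨟ ((mk (X 1 1 4)) ⊠ mk (wires 1)) = (mk (X 1 1 4)) ⨟ mk (Z 1 2 0) ⨟ (mk (wires 1) ⊠ (mk (X 1 1 4))) from by
      rw [K1_red, seq_assoc, par_eq_seq_left (mk (X 1 1 4)) (mk (X 1 1 4)), seq_assoc, ← wires_par_seq, xphase_seq_xphase,
        show (4 : ZMod 8) + 4 = 0 from by decide, X_one_one, wires_par_wires, seq_id],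
    seq_assoc, seq_assoc, ← wires_par_seq, ← seq_assoc (mk (X 1 1 4)) (mk triangle), X_pi_seq_triangle, seq_assoc _ (mk (X 1 1 4)) (mk (Z 1 0 0)), X_phase_pi_seq_Z_effect]

/-- The identity wire as half the node with both pendants:
`(𝕀 ⊗ (Z^{(0,1)} ⨾ T)) ⨾ Z^{(2,1)} ⨾ Z^{(1,2)} ⨾ (𝕀 ⊗ (T ⨾ Z^{(1,0)})) = Z^{(0,0)} ⊗ 𝕀` (`2Id-is-C2-times-anti-C2`, bent).
[cite: JeandelPerdrixVilmart2018, §2.2; JPV LICS 2019 Appendix (`2Id-is-C2-times-anti-C2`)] -/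
theorem stateT_merge_seq_split_triangleEffect : (mk (wires 1) ⊠ (mk (Z 0 1 0) ⨟ mk triangle)) ⨟ mk (Z 2 1 0) ⨟ (mk (Z 1 2 0) ⨟ (mk (wires 1) ⊠ (mk triangle ⨟ mk (Z 1 0 0)))) = mk (Z 0 0 0) ⊠ mk (wires 1) := by
  rw [split_par_triangleEffect_eq_par_stateT_merge, seq_assoc _ (mk (Z 2 1 0)), ← seq_assoc (mk (Z 2 1 0)),
    show mk (Z 2 1 0) ⨟ (mk (wires 1) ⊠ (mk (Z 0 1 0) ⨟ (mk triangle).transpose)) = (mk (wires 2) ⊠ (mk (Z 0 1 0) ⨟ (mk triangle).transpose)) ⨟ (mk (Z 2 1 0) ⊠ mk (wires 1)) from by rw [← par_eq_seq_right, par_eq_seq_left (mk (Z 2 1 0)) (mk (Z 0 1 0) ⨟ (mk triangle).transpose), par_empty],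
    seq_assoc, Z_par_seq_Z 2 1 1 1 le_rfl, add_zero (0 : ZMod 8), ← seq_assoc,
    show (mk (wires 1) ⊠ (mk (Z 0 1 0) ⨟ mk triangle)) ⨟ (mk (wires 2) ⊠ (mk (Z 0 1 0) ⨟ (mk triangle).transpose)) = mk (wires 1) ⊠ (((mk (Z 0 1 0) ⨟ mk triangle) ⊠ (mk (Z 0 1 0) ⨟ (mk triangle).transpose)) ⨟ mk swap ⨟ mk swap) from by
      rw [seq_assoc, swap_seq_swap, seq_id, show mk (wires 2) ⊠ (mk (Z 0 1 0) ⨟ (mk triangle).transpose) = mk (wires 1) ⊠ (mk (wires 1) ⊠ (mk (Z 0 1 0) ⨟ (mk triangle).transpose)) from by rw [← wires_par_wires 1 1]; exact (par_assoc _ _ _).trans (cast_id _ _ _),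
        ← wires_par_seq, par_eq_seq_left (mk (Z 0 1 0) ⨟ mk triangle) (mk (Z 0 1 0) ⨟ (mk triangle).transpose), par_empty],
    states_seq_swap, show mk (Z (2 + 1) 1 0) = (mk (wires 1) ⊠ mk (Z 2 1 0)) ⨟ mk (Z 2 1 0) from by rw [par_Z_seq_Z 1 2 1 1 le_rfl, add_zero (0 : ZMod 8)],
    ← seq_assoc, ← wires_par_seq, seq_assoc ((mk (Z 0 1 0) ⨟ (mk triangle).transpose) ⊠ (mk (Z 0 1 0) ⨟ mk triangle)) (mk swap) (mk (Z 2 1 0)), swap_seq_Z, two_id_is_c2_times_anti_c2,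
    show mk (wires 1) ⊠ (mk (Z 0 0 0) ⊠ mk (Z 0 1 0)) = mk (Z 0 0 0) ⊠ (mk (wires 1) ⊠ mk (Z 0 1 0)) from by
      rw [show mk (wires 1) ⊠ (mk (Z 0 0 0) ⊠ mk (Z 0 1 0)) = (mk (wires 1) ⊠ mk (Z 0 0 0)) ⊠ mk (Z 0 1 0) from (par_assoc' _ _ _).trans (cast_id _ _ _), ← scalar_par_wires]
      exact (par_assoc _ _ _).trans (cast_id _ _ _),
    show ∀ (s : ZXClass 0 0) (A : ZXClass 1 2) (B : ZXClass 2 1), (s ⊠ A) ⨟ B = s ⊠ (A ⨟ B) from fun s A B => by rw [scalar_par_seq_left, empty_par, cast_id],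
    par_Z_seq_Z 1 0 1 1 le_rfl, add_zero (0 : ZMod 8), Z_one_one]

/-- Appendix Lemma 33 with the Hadamard taken to the right: `Z^{(1,2)} ⨾ (T ⊗ (Tᵗ ⨾ Z^{(1,0)})) = √2 ⊗ (X(π) ⨾ T ⨾ H)`.
[cite: JeandelPerdrixVilmart2018, Appendix Lemma 33] -/
theorem split_seq_triangle_par_pendant : mk (Z 1 2 0) ⨟ (mk triangle ⊠ ((mk triangle).transpose ⨟ mk (Z 1 0 0))) = mk (dumbbell 0 0) ⊠ ((mk (X 1 1 4)) ⨟ mk triangle ⨟ mk hBox) := by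
  have h := split_seq_triangle_hBox_par_pendant
  rw [show (mk triangle ⨟ mk hBox) ⊠ ((mk triangle).transpose ⨟ mk (Z 1 0 0)) = (mk triangle ⊠ ((mk triangle).transpose ⨟ mk (Z 1 0 0))) ⨟ (mk hBox ⊠ mk (wires 0)) from by rw [interchange, seq_id], par_empty, ← seq_assoc] at h
  have h2 := congrArg (· ⨟ mk hBox) h
  simp only [seq_assoc, hBox_seq_hBox, seq_id, scalar_par_seq_one] at h2
  simpa only [seq_assoc] using h2

/-- Appendix Lemma 33, transposed: `((H ⨾ Tᵗ) ⊗ (Z^{(0,1)} ⨾ T)) ⨾ Z^{(2,1)} = √2 ⊗ (Tᵗ ⨾ X(π))`. [cite: JeandelPerdrixVilmart2018, Appendix Lemma 33] -/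
theorem hBox_triangleT_par_pendantState_seq_merge : ((mk hBox ⨟ (mk triangle).transpose) ⊠ (mk (Z 0 1 0) ⨟ mk triangle)) ⨟ mk (Z 2 1 0) = mk (dumbbell 0 0) ⊠ ((mk triangle).transpose ⨟ (mk (X 1 1 4))) := by
  have h := congrArg transpose split_seq_triangle_hBox_par_pendant
  rw [transpose_seq, transpose_par, transpose_seq, transpose_seq, transpose_transpose, transpose_mk (Z 1 2 0), transpose_mk hBox, transpose_mk (Z 1 0 0),
    ZXDiagram.transpose_Z, ZXDiagram.transpose_Z, ZXDiagram.transpose_hBox, transpose_par, transpose_seq, transpose_mk (dumbbell 0 0), mk_transpose_dumbbell,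
    transpose_mk (X 1 1 4), ZXDiagram.transpose_X] at h
  exact h

/-- **JPV LICS 2019, Lemma `2-through-triangle`** (NF-L5): the doubling node passes through `Tᵗ` at the cost of one
more `Tᵗ`: `(Z^{(1,2)} ⨾ (𝕀 ⊗ (T ⨾ Z^{(1,0)}))) ⨾ Tᵗ ⨾ Tᵗ = Tᵗ ⨾ (Z^{(1,2)} ⨾ (𝕀 ⊗ (T ⨾ Z^{(1,0)})))`.
[cite: JeandelPerdrixVilmart2018, Appendix Lemmas 21, 31, 33; JPV LICS 2019 Appendix (proof of `2-through-triangle`)] -/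
theorem doublingNode_seq_two_triangleT : (mk (Z 1 2 0) ⨟ (mk (wires 1) ⊠ (mk triangle ⨟ mk (Z 1 0 0)))) ⨟ (mk triangle).transpose ⨟ (mk triangle).transpose = (mk triangle).transpose ⨟ (mk (Z 1 2 0) ⨟ (mk (wires 1) ⊠ (mk triangle ⨟ mk (Z 1 0 0)))) := by
  have hDT : (mk (Z 1 2 0) ⨟ (mk (wires 1) ⊠ ((mk triangle).transpose ⨟ mk (Z 1 0 0)))) ⨟ mk triangle = mk (dumbbell 0 0) ⊠ ((mk (X 1 1 4)) ⨟ mk triangle ⨟ mk hBox) := by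
    rw [seq_assoc, show (mk (wires 1) ⊠ ((mk triangle).transpose ⨟ mk (Z 1 0 0))) ⨟ mk triangle = mk triangle ⊠ ((mk triangle).transpose ⨟ mk (Z 1 0 0)) from by rw [par_eq_seq_right (mk triangle) ((mk triangle).transpose ⨟ mk (Z 1 0 0)), par_empty], split_seq_triangle_par_pendant]
  have hK : mk (dumbbell 0 0) ⊠ (mk (dumbbell 0 0) ⊠ (mk triangle ⨟ mk (Z 1 1 4) ⨟ mk hBox ⨟ (mk triangle).transpose)) = mk (dumbbell 0 0) ⊠ ((mk triangle).transpose ⨟ (mk (Z 1 2 0) ⨟ (mk (wires 1) ⊠ (mk triangle ⨟ mk (Z 1 0 0))))) := by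
    rw [show mk (dumbbell 0 0) ⊠ (mk (dumbbell 0 0) ⊠ (mk triangle ⨟ mk (Z 1 1 4) ⨟ mk hBox ⨟ (mk triangle).transpose)) = (mk (dumbbell 0 0) ⊠ mk (dumbbell 0 0)) ⊠ (mk triangle ⨟ mk (Z 1 1 4) ⨟ mk hBox ⨟ (mk triangle).transpose) from (par_assoc' _ _ _).trans (cast_id _ _ _),
      ← two_eq_sqrt_two_sq, ← seq_id (mk triangle ⨟ mk (Z 1 1 4) ⨟ mk hBox ⨟ (mk triangle).transpose), ← seq_scalar_par_one, ← stateT_merge_seq_split_triangleEffect,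
      ← seq_assoc _ ((mk (wires 1) ⊠ (mk (Z 0 1 0) ⨟ mk triangle)) ⨟ mk (Z 2 1 0)) (mk (Z 1 2 0) ⨟ (mk (wires 1) ⊠ (mk triangle ⨟ mk (Z 1 0 0)))), seq_assoc ((mk triangle ⨟ mk (Z 1 1 4)) ⨟ mk hBox) ((mk triangle).transpose) ((mk (wires 1) ⊠ (mk (Z 0 1 0) ⨟ mk triangle)) ⨟ mk (Z 2 1 0)),
      seq_assoc (mk triangle ⨟ mk (Z 1 1 4)) (mk hBox) ((mk triangle).transpose ⨟ ((mk (wires 1) ⊠ (mk (Z 0 1 0) ⨟ mk triangle)) ⨟ mk (Z 2 1 0))), ← seq_assoc (mk hBox) ((mk triangle).transpose) ((mk (wires 1) ⊠ (mk (Z 0 1 0) ⨟ mk triangle)) ⨟ mk (Z 2 1 0)),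
      ← seq_assoc (mk hBox ⨟ (mk triangle).transpose) (mk (wires 1) ⊠ (mk (Z 0 1 0) ⨟ mk triangle)) (mk (Z 2 1 0)),
      show (mk hBox ⨟ (mk triangle).transpose) ⨟ (mk (wires 1) ⊠ (mk (Z 0 1 0) ⨟ mk triangle)) = (mk hBox ⨟ (mk triangle).transpose) ⊠ (mk (Z 0 1 0) ⨟ mk triangle) from by rw [par_eq_seq_left (mk hBox ⨟ (mk triangle).transpose) (mk (Z 0 1 0) ⨟ mk triangle), par_empty],
      hBox_triangleT_par_pendantState_seq_merge, seq_scalar_par_one, scalar_par_seq_one, ← seq_assoc (mk triangle ⨟ mk (Z 1 1 4)) ((mk triangle).transpose) (mk (X 1 1 4)), triangle_seq_Z_pi_seq_triangleT,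
      ← triangle_transpose_eq]
  nth_rewrite 1 [triangle_transpose_eq]
  rw [← seq_assoc (mk (Z 1 2 0) ⨟ (mk (wires 1) ⊠ (mk triangle ⨟ mk (Z 1 0 0)))) ((mk (X 1 1 4)) ⨟ mk triangle) (mk (X 1 1 4)), ← seq_assoc (mk (Z 1 2 0) ⨟ (mk (wires 1) ⊠ (mk triangle ⨟ mk (Z 1 0 0)))) (mk (X 1 1 4)) (mk triangle), doublingNode_seq_X_pi, seq_assoc (mk (X 1 1 4)) (mk (Z 1 2 0) ⨟ (mk (wires 1) ⊠ ((mk triangle).transpose ⨟ mk (Z 1 0 0)))) (mk triangle), hDT, seq_scalar_par_one,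
    ← seq_assoc (mk (X 1 1 4)) ((mk (X 1 1 4)) ⨟ mk triangle) (mk hBox), ← seq_assoc (mk (X 1 1 4)) (mk (X 1 1 4)) (mk triangle), xphase_seq_xphase, show (4 : ZMod 8) + 4 = 0 from by decide, X_one_one, id_seq,
    scalar_par_seq_one, scalar_par_seq_one, seq_assoc (mk triangle ⨟ mk hBox) (mk (X 1 1 4)) (mk triangle).transpose, seq_assoc (mk triangle) (mk hBox) ((mk (X 1 1 4)) ⨟ (mk triangle).transpose), ← seq_assoc (mk hBox) (mk (X 1 1 4)) (mk triangle).transpose, hBox_seq_X_phase,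
    ← seq_assoc (mk triangle), ← seq_assoc (mk triangle)]
  exact cancel_sqrt_two_left hK

end ZXClass

end Literature.Computability.QuantumComplexity
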